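import Mathlib
import Summits.ValiantsHypothesis.ValiantsHypothesis.Theses.ElementaryWordLength
import Literature.Computability.AlgebraicComplexity.NewtonPolygonTau
import Literature.Computability.AlgebraicComplexity.TauConjecture

/-!
# Sketch — crux-ideate `stmt-ValiantsHypothesis-6626` (`WordPerSuperPoly`), ideator 1, round 1

First-lemma signatures for the two idea cards (no proofs; statements must elaborate):

* card `newton-shadow-word-tau`: `sparseWordEntry`, `TropicalWordBound` (first lemma, provable),
  `NewtonWordTauPoly` / `NewtonWordTauSlow` (the transferred crux C⁺, two strengths),
  `BirkhoffShadowRich` (bridge A, Mulmuley–Shah 2001 Thm 1.3 + path→matching),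
  `WordSpecialises` (glue), and the target shape `NewtonWordTauPoly → BirkhoffShadowRich →
  WordSpecialises → WordPerSuperPoly` (composition left to crux-plan).
* card `real-rooted-theta-word-tau`: `realWordEntry`, `PositiveWordsNoPositiveRoots` (first rung),
  `RealWordTauSlow` (C⁺), `ThetaSectionsRealRooted` (bridge, elementary dominant-term argument).
-/

noncomputable section

set_option linter.dupNamespace false

namespace Summit.ValiantsHypothesis.ValiantsHypothesis.Cruxes.WordPerSuperPoly.Sketch

open MvPolynomial Literature.Computability.AlgebraicComplexity

/-! ### Card 1 — Newton-polygon shadows of width-3 words -/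

/-- A sparse bivariate letter `(i, j, c, (a, b))` is the transvection `E_ij(c · x^a y^b)`;
`sparseWordEntry w` is the `(0,2)` entry of the product of the letters of `w`. -/
def sparseWordEntry (w : List (Fin 3 × Fin 3 × ℂ × (ℕ × ℕ))) : MvPolynomial (Fin 2) ℂ :=
  (w.map (fun l => Matrix.transvection l.1 l.2.1
    (C l.2.2.1 * (X 0 ^ l.2.2.2.1 * X 1 ^ l.2.2.2.2)))).prod 0 2

/-- FIRST LEMMA (tropical / cancellation-free case, provable now): if all coefficients are positive
reals there is no cancellation, the support is the full path-sum set, and the Newton polygon of the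
`(0,2)` entry has at most `6·L^{log₂ 6} ≤ 6 (L+1)^3` vertices (vertex-subadditivity of Minkowski sum
and of hull-of-union along the divide-and-conquer `M[s,t] = M[s,u]·M[u,t]`, three middle registers). -/
def TropicalWordBound : Prop :=
  ∀ w : List (Fin 3 × Fin 3 × ℂ × (ℕ × ℕ)), (∀ l ∈ w, l.1 ≠ l.2.1) →
    (∀ l ∈ w, ∃ r : ℝ, 0 < r ∧ l.2.2.1 = (r : ℂ)) →
    newtonVertexCount (sparseWordEntry w) ≤ 6 * (w.length + 1) ^ 3

/-- C⁺, polynomial form (word τ-conjecture for Newton polygons): cancellation buys at most a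
polynomial number of Newton vertices at width 3. -/
def NewtonWordTauPoly : Prop :=
  ∃ c : ℕ, ∀ w : List (Fin 3 × Fin 3 × ℂ × (ℕ × ℕ)), (∀ l ∈ w, l.1 ≠ l.2.1) →
    newtonVertexCount (sparseWordEntry w) ≤ c * (w.length + 1) ^ c

/-- C⁺, safe form: vertices `≤ 2^(2^(K·√(log L)))` — super-quasi-polynomial tolerance, still
`2^{L^{o(1)}}`, which is all bridge B needs and which det's quasi-polynomial words cannot violate
whatever the shadow complexity of the Birkhoff polytope is. -/
def NewtonWordTauSlow : Prop :=
  ∃ K : ℝ, ∀ w : List (Fin 3 × Fin 3 × ℂ × (ℕ × ℕ)), (∀ l ∈ w, l.1 ≠ l.2.1) → 2 ≤ w.length →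
    (newtonVertexCount (sparseWordEntry w) : ℝ) ≤
      (2 : ℝ) ^ ((2 : ℝ) ^ (K * Real.sqrt (Real.log (w.length : ℝ))))

/-- BRIDGE A (intrinsic; Mulmuley–Shah 2001 Thm 1.3 = Carstensen 1983, plus the layered-DAG
`s`-`t` path ↦ bipartite perfect matching reduction): some 0/1/monomial specialisation of `per_n` has a
Newton polygon with `2^{c·log² n}` vertices (parametric assignment has that many breakpoints). -/
def BirkhoffShadowRich : Prop :=
  ∃ c : ℝ, 0 < c ∧ ∃ n₀ : ℕ, ∀ n ≥ n₀, ∃ g : Fin n × Fin n → MvPolynomial (Fin 2) ℂ,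
    (∀ kl, g kl = 0 ∨ g kl = 1 ∨ ∃ a b : ℕ, g kl = X 0 ^ a * X 1 ^ b) ∧
    (2 : ℝ) ^ (c * Real.log (n : ℝ) ^ 2) ≤ (newtonVertexCount (aeval g (perPoly (Fin n) ℂ)) : ℝ)

/-- GLUE (provable now): specialising the variables of a crux word by `0`, `1` or monomials
`x^a y^b` gives a sparse bivariate word, no longer, computing the specialised permanent. -/
def WordSpecialises : Prop :=
  ∀ (n : ℕ) (g : Fin n × Fin n → MvPolynomial (Fin 2) ℂ),
    (∀ kl, g kl = 0 ∨ g kl = 1 ∨ ∃ a b : ℕ, g kl = X 0 ^ a * X 1 ^ b) →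
    ∀ w : List (Fin 3 × Fin 3 × ℂ × Option (Fin n × Fin n)), (∀ l ∈ w, l.1 ≠ l.2.1) →
      (w.map (fun l => Matrix.transvection l.1 l.2.1
        (MvPolynomial.C l.2.2.1 * l.2.2.2.elim 1 MvPolynomial.X))).prod =
          Matrix.transvection (0 : Fin 3) 2 (perPoly (Fin n) ℂ) →
      ∃ w' : List (Fin 3 × Fin 3 × ℂ × (ℕ × ℕ)), w'.length ≤ w.length ∧ (∀ l ∈ w', l.1 ≠ l.2.1) ∧
        sparseWordEntry w' = aeval g (perPoly (Fin n) ℂ)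

/-- Shape of the line (composition is crux-plan's job, NOT claimed here): the polynomial form with
bridge A concludes the crux BY NAME. -/
def LineShapeA : Prop :=
  NewtonWordTauPoly → BirkhoffShadowRich → WordSpecialises →
    Summit.ValiantsHypothesis.ValiantsHypothesis.Theses.ElementaryWordLength.WordPerSuperPoly

/-! ### Card 2 — real zeros of signed univariate words (theta-section bridge) -/

/-- A signed sparse univariate letter `(i, j, c, e)` is `E_ij(c · t^e)`, `c ∈ ℝ`; the `(0,2)` entry. -/
def realWordEntry (w : List (Fin 3 × Fin 3 × ℝ × ℕ)) : Polynomial ℝ :=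
  (w.map (fun l => Matrix.transvection l.1 l.2.1
    (Polynomial.C l.2.2.1 * Polynomial.X ^ l.2.2.2))).prod 0 2

/-- FIRST RUNG (provable now): positive words have no positive real zeros (all path coefficients are
positive) — every real zero of a word entry is paid for by sign structure. -/
def PositiveWordsNoPositiveRoots : Prop :=
  ∀ w : List (Fin 3 × Fin 3 × ℝ × ℕ), (∀ l ∈ w, l.1 ≠ l.2.1) → (∀ l ∈ w, 0 < l.2.2.1) →
    ∀ t : ℝ, 0 < t → realWordEntry w = 0 ∨ (realWordEntry w).eval t ≠ 0

/-- C⁺ (real word τ, safe form): distinct real zeros `≤ 2^(2^(K √ log L))`. -/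
def RealWordTauSlow : Prop :=
  ∃ K : ℝ, ∀ w : List (Fin 3 × Fin 3 × ℝ × ℕ), (∀ l ∈ w, l.1 ≠ l.2.1) → 2 ≤ w.length →
    (((realWordEntry w).roots.toFinset.card : ℕ) : ℝ) ≤
      (2 : ℝ) ^ ((2 : ℝ) ^ (K * Real.sqrt (Real.log (w.length : ℝ))))

/-- C⁺ (real word τ, polynomial form). -/
def RealWordTauPoly : Prop :=
  ∃ c : ℕ, ∀ w : List (Fin 3 × Fin 3 × ℝ × ℕ), (∀ l ∈ w, l.1 ≠ l.2.1) →
    (realWordEntry w).roots.toFinset.card ≤ c * (w.length + 1) ^ c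

/-- BRIDGE (elementary dominant-term argument; cf. Katkova–Lobova–Vishnyakova 2003, Hutchinson):
the theta section `Σ_{a<2^m} 4^{-a²} t^a` has `2^m - 1` distinct (negative) real zeros — it is the
Kronecker image `u_i ↦ t^{2^i}`, `v_j ↦ 4^{-2^j}` of KPTT's `VNP` family `Σ_a u^{bits a} v^{bits a²}`. -/
def ThetaSectionsRealRooted : Prop :=
  ∀ m : ℕ, (∑ a ∈ Finset.range (2 ^ m),
      Polynomial.C ((1 / 4 : ℝ) ^ (a ^ 2)) * Polynomial.X ^ a).roots.toFinset.card = 2 ^ m - 1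

end Summit.ValiantsHypothesis.ValiantsHypothesis.Cruxes.WordPerSuperPoly.Sketch
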